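import Mathlib.FieldTheory.Galois.Infinite
import Literature.AnabelianGeometry.AbsoluteAnabelian.AbsTopIII.KummerFaithful
import Literature.AnabelianGeometry.EtaleTheta.KummerFieldUnits
import HarnessLib

/-!
# [AbsTopIII] Def. 1.5 (b) for tori: Kummer-injectivity, and the equivalence (a) ⇔ (b)

Mochizuki, *Topics in Absolute Anabelian Geometry III*, §1, Def. 1.5, manuscript p. 32 (lit key
`paper:url-5493eb38cbb7`): "we shall say that `k` is Kummer-faithful (respectively, torally
Kummer-faithful) if, for every finite extension `k_H ⊆ k̄` of `k`, where we write
`H := Gal(k̄/k_H) ⊆ G_k`, and every semi-abelian variety (respectively, every torus) `A` over `k_H`,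
either of the following two equivalent conditions is satisfied: (a) We have `⋂_{N ≥ 1} N·A(k_H) = {0}`
[...]. (b) The associated Kummer map `A(k_H) → H¹(H, Hom(ℚ/ℤ, A(k̄)))` is an injection. [To verify
the equivalence of (a) and (b), it suffices to consider [...] the long exact sequences [...]
associated to `0 → _N A → A → A → 0`.]"

`KummerFaithful.lean` typed the TORAL notion through condition (a) for `𝔾_m` over all finite
extensions (`IsTorallyKummerFaithful`) and recorded "(b) is not typed (it needs the Kummer map)".
The Kummer map `A^H → H¹(H, Λ(A))` of a group `H` acting on `A = (k̄)^×` is now in the tree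
(`EtaleTheta.kummerMapFixed`, abc-iut L2; with `Λ = Hom(ℚ/ℤ, ·)` realised as compatible torsion
systems and `H¹` Mathlib's group cohomology), together with the injectivity criterion
`EtaleTheta.kummerMapFixed_injective_iff_absoluteGaloisGroup` (`KummerFieldUnits.lean`).  Hence:

* `Def_1_5_b_toral k` — condition (b) for `A = 𝔾_m`: for every OPEN subgroup `H ≤ G_k`
  (= `Gal(k̄/k_H)` of a finite extension), the Kummer map `((k̄)^×)^H → H¹(H, Λ((k̄)^×))` is
  injective;
* `isTorallyKummerFaithful_iff_def_1_5_b_toral` — **(a) ⇔ (b) for tori, PROVED** (the Galois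
  correspondence `H` open `↔` `k̄^H` finite over `k`, `((k̄)^×)^H = (k̄^H)^×`, plus the cited criterion).

As in `KummerFaithful.lean`, tori are reduced to `𝔾_m` over finite extensions (splitting / Weil
restriction, Rmk. 1.5.2); `H¹` here is the cohomology of the abstract group `H` — for the
injectivity statement this agrees with continuous cohomology (a continuous cocycle that is a
coboundary is a continuous coboundary).  Universe: `k : Type` (Mathlib's `Rep ℤ H`).
-/

noncomputable section

open scoped Classical

namespace Literature.AnabelianGeometry.AbsoluteAnabelian.AbsTopIII

open Literature.AnabelianGeometry.EtaleTheta

/-- **Def. 1.5 (b) for tori**: "The associated Kummer map `A(k_H) → H¹(H, Hom(ℚ/ℤ, A(k̄)))` is an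
injection" for `A = 𝔾_m` and every finite extension `k_H` of `k`, i.e. every OPEN subgroup
`H = Gal(k̄/k_H) ≤ G_k` — with `A(k_H) = ((k̄)^×)^H`, `Hom(ℚ/ℤ, A(k̄)) = Λ((k̄)^×)` and the Kummer map
`EtaleTheta.kummerMapFixed`. [cite: MochizukiAbsTopIII2015, Def 1.5 (b) p.32] -/
def Def_1_5_b_toral (k : Type) [Field k] : Prop :=
  ∀ H : Subgroup (Field.absoluteGaloisGroup k), IsOpen (H : Set (Field.absoluteGaloisGroup k)) →
    Function.Injective (kummerMapFixed (A := (AlgebraicClosure k)ˣ) H)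

section Galois

variable (k : Type) [Field k]

/-- The identification `G_k = Aut_k(k̄)` (the tree's `toAlgEquiv`, the identity) is continuous.
[cite: MochizukiAbsTopIII2015, Def 1.5 p.32] -/
theorem continuous_toAlgEquiv :
    Continuous (Field.absoluteGaloisGroup.toAlgEquiv k :
      Field.absoluteGaloisGroup k → (AlgebraicClosure k ≃ₐ[k] AlgebraicClosure k)) :=
  continuous_def.2 fun _ hs => hs

/-- … and so is its inverse. [cite: MochizukiAbsTopIII2015, Def 1.5 p.32] -/
theorem continuous_toAlgEquiv_symm :
    Continuous ((Field.absoluteGaloisGroup.toAlgEquiv k).symm :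
      (AlgebraicClosure k ≃ₐ[k] AlgebraicClosure k) → Field.absoluteGaloisGroup k) :=
  continuous_def.2 fun _ hs => hs

variable {k}

/-- A subgroup `H ≤ G_k` viewed in `Aut_k(k̄)`. [cite: MochizukiAbsTopIII2015, Def 1.5 p.32] -/
def galSubgroup (H : Subgroup (Field.absoluteGaloisGroup k)) :
    Subgroup (AlgebraicClosure k ≃ₐ[k] AlgebraicClosure k) :=
  H.map (Field.absoluteGaloisGroup.toAlgEquiv k).toMonoidHom

/-- Membership in `galSubgroup H`. [cite: MochizukiAbsTopIII2015, Def 1.5 p.32] -/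
theorem mem_galSubgroup {H : Subgroup (Field.absoluteGaloisGroup k)}
    {σ : AlgebraicClosure k ≃ₐ[k] AlgebraicClosure k} :
    σ ∈ galSubgroup H ↔ (Field.absoluteGaloisGroup.toAlgEquiv k).symm σ ∈ H :=
  Subgroup.mem_map_equiv

/-- `galSubgroup H` is open when `H` is. [cite: MochizukiAbsTopIII2015, Def 1.5 p.32] -/
theorem isOpen_galSubgroup {H : Subgroup (Field.absoluteGaloisGroup k)}
    (hH : IsOpen (H : Set (Field.absoluteGaloisGroup k))) :
    IsOpen (galSubgroup H : Set (AlgebraicClosure k ≃ₐ[k] AlgebraicClosure k)) := by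
  have : (galSubgroup H : Set (AlgebraicClosure k ≃ₐ[k] AlgebraicClosure k)) =
      (Field.absoluteGaloisGroup.toAlgEquiv k).symm ⁻¹' (H : Set (Field.absoluteGaloisGroup k)) :=
    Set.ext fun _ => mem_galSubgroup
  rw [this]
  exact hH.preimage (continuous_toAlgEquiv_symm k)

/-- `((k̄)^×)^H` consists of the units whose value lies in the fixed field `k̄^H`.
[cite: MochizukiAbsTopIII2015, Def 1.5 p.32] -/
theorem mem_invariants_iff (H : Subgroup (Field.absoluteGaloisGroup k)) (u : (AlgebraicClosure k)ˣ) :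
    u ∈ invariants (A := (AlgebraicClosure k)ˣ) H ↔
      (u : AlgebraicClosure k) ∈ IntermediateField.fixedField (galSubgroup H) := by
  rw [IntermediateField.mem_fixedField_iff]
  change (∀ m : H, m • u = u) ↔ _
  constructor
  · intro h f hf
    have h1 := h ⟨(Field.absoluteGaloisGroup.toAlgEquiv k).symm f, mem_galSubgroup.mp hf⟩
    have h2 := congrArg Units.val h1
    rw [Subgroup.mk_smul, Units.coe_smul, Field.absoluteGaloisGroup.smul_def] at h2
    exact h2
  · intro h m
    apply Units.ext
    rw [Subgroup.mk_smul, Units.coe_smul, Field.absoluteGaloisGroup.smul_def]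
    exact h _ (by
      rw [mem_galSubgroup]
      exact m.2)

/-- A unit of `k̄` with value in an intermediate field `L`, as a unit of `L`.
[cite: MochizukiAbsTopIII2015, Def 1.5 p.32] -/
def unitOfMem (L : IntermediateField k (AlgebraicClosure k)) (u : (AlgebraicClosure k)ˣ)
    (hu : (u : AlgebraicClosure k) ∈ L) : (L)ˣ :=
  Units.mk0 ⟨u, hu⟩ fun h => u.ne_zero (congrArg Subtype.val h)

/-- Value of `unitOfMem`. [cite: MochizukiAbsTopIII2015, Def 1.5 p.32] -/
@[simp] theorem coe_coe_unitOfMem (L : IntermediateField k (AlgebraicClosure k))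
    (u : (AlgebraicClosure k)ˣ) (hu : (u : AlgebraicClosure k) ∈ L) :
    (((unitOfMem L u hu : (L)ˣ) : L) : AlgebraicClosure k) = u :=
  rfl

variable [CharZero k]

/-- For an OPEN subgroup `H ≤ G_k` the fixed field `k̄^H` is a finite extension of `k` (infinite
Galois correspondence: "every finite extension `k_H ⊆ k̄` of `k`, where we write
`H := Gal(k̄/k_H) ⊆ G_k`", p. 32). [cite: MochizukiAbsTopIII2015, Def 1.5 p.32] -/
theorem finiteDimensional_fixedField_of_isOpen (H : Subgroup (Field.absoluteGaloisGroup k))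
    (hH : IsOpen (H : Set (Field.absoluteGaloisGroup k))) :
    FiniteDimensional k (IntermediateField.fixedField (galSubgroup H)) := by
  have hopen := isOpen_galSubgroup hH
  have hclosed : IsClosed (galSubgroup H : Set (AlgebraicClosure k ≃ₐ[k] AlgebraicClosure k)) :=
    Subgroup.isClosed_of_isOpen _ hopen
  let Hc : ClosedSubgroup (AlgebraicClosure k ≃ₐ[k] AlgebraicClosure k) := ⟨galSubgroup H, hclosed⟩
  have hfix : (IntermediateField.fixedField (galSubgroup H)).fixingSubgroup = galSubgroup H :=
    InfiniteGalois.fixingSubgroup_fixedField Hc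
  refine (InfiniteGalois.isOpen_iff_finite _).mp ?_
  change IsOpen ((IntermediateField.fixedField (galSubgroup H)).fixingSubgroup :
    Set (AlgebraicClosure k ≃ₐ[k] AlgebraicClosure k))
  rw [hfix]
  exact hopen

/-- **(a) ⇒ (b) for tori**: a torally Kummer-faithful field satisfies Def. 1.5 (b) for `𝔾_m`.
[cite: MochizukiAbsTopIII2015, Def 1.5 p.32] -/
theorem def_1_5_b_toral_of_isTorallyKummerFaithful (h : IsTorallyKummerFaithful k) :
    Def_1_5_b_toral k := by
  intro H hH
  rw [kummerMapFixed_injective_iff_absoluteGaloisGroup]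
  intro a ha
  haveI := finiteDimensional_fixedField_of_isOpen H hH
  set L := IntermediateField.fixedField (galSubgroup H) with hLdef
  have hL : DivisibleElementsTrivial (L)ˣ := h.units L inferInstance
  have hamem : ((a : (AlgebraicClosure k)ˣ) : AlgebraicClosure k) ∈ L :=
    (mem_invariants_iff H _).mp a.2
  have hone : unitOfMem L (a : (AlgebraicClosure k)ˣ) hamem = 1 := by
    refine hL.eq_one_of_forall_exists_pow _ fun n hn => ?_
    obtain ⟨b, hb⟩ := ha ⟨n, hn⟩
    have hbmem : ((b : (AlgebraicClosure k)ˣ) : AlgebraicClosure k) ∈ L :=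
      (mem_invariants_iff H _).mp b.2
    refine ⟨unitOfMem L (b : (AlgebraicClosure k)ˣ) hbmem, ?_⟩
    apply Units.ext
    apply Subtype.ext
    have hb' := congrArg (fun x : invariants (A := (AlgebraicClosure k)ˣ) H =>
      (((x : (AlgebraicClosure k)ˣ) : AlgebraicClosure k))) hb
    simpa using hb'
  have hval : ((a : (AlgebraicClosure k)ˣ) : AlgebraicClosure k) = 1 := by
    have := congrArg (fun x : (L)ˣ => ((x : L) : AlgebraicClosure k)) hone
    simpa using this
  apply Subtype.ext
  exact Units.ext hval

/-- **(b) ⇒ (a) for tori**: Def. 1.5 (b) for `𝔾_m` implies that `k` is torally Kummer-faithful.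
[cite: MochizukiAbsTopIII2015, Def 1.5 p.32] -/
theorem isTorallyKummerFaithful_of_def_1_5_b_toral (h : Def_1_5_b_toral k) :
    IsTorallyKummerFaithful k := by
  refine ⟨inferInstance, fun k' _ _ hfin => ⟨fun x hx => ?_⟩⟩
  haveI : Module.Finite k k' := hfin
  haveI : Algebra.IsAlgebraic k k' := Algebra.IsAlgebraic.of_finite k k'
  let φ : k' →ₐ[k] AlgebraicClosure k := IsAlgClosed.lift
  let L : IntermediateField k (AlgebraicClosure k) := φ.fieldRange
  have hmem : ∀ y : k', φ y ∈ L := fun y => ⟨y, rfl⟩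
  haveI : FiniteDimensional k L := by
    let f : k' →ₗ[k] L :=
      { toFun := fun y => ⟨φ y, hmem y⟩
        map_add' := fun y z => Subtype.ext (map_add φ y z)
        map_smul' := fun c y => Subtype.ext (by simp) }
    refine Module.Finite.of_surjective f fun z => ?_
    obtain ⟨y, hy⟩ := (AlgHom.mem_fieldRange).mp z.2
    exact ⟨y, Subtype.ext hy⟩
  -- the open subgroup `Gal(k̄/L)` pulled back to `G_k`
  let H : Subgroup (Field.absoluteGaloisGroup k) :=
    L.fixingSubgroup.comap (Field.absoluteGaloisGroup.toAlgEquiv k).toMonoidHom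
  have hH : IsOpen (H : Set (Field.absoluteGaloisGroup k)) :=
    (IntermediateField.fixingSubgroup_isOpen L).preimage (continuous_toAlgEquiv k)
  have hinj := h H hH
  rw [kummerMapFixed_injective_iff_absoluteGaloisGroup] at hinj
  -- units of `k̄` coming from `k'` are `H`-invariant
  have hinv : ∀ (u : (AlgebraicClosure k)ˣ), (u : AlgebraicClosure k) ∈ L →
      u ∈ invariants (A := (AlgebraicClosure k)ˣ) H := by
    intro u hu m
    apply Units.ext
    rw [Subgroup.mk_smul, Units.coe_smul, Field.absoluteGaloisGroup.smul_def]
    have hm : Field.absoluteGaloisGroup.toAlgEquiv k (m : Field.absoluteGaloisGroup k) ∈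
        L.fixingSubgroup := m.2
    rw [IntermediateField.mem_fixingSubgroup_iff] at hm
    exact hm _ hu
  have hφinj : Function.Injective φ := φ.toRingHom.injective
  let toUnit : k'ˣ → (AlgebraicClosure k)ˣ := fun y => Units.map (φ : k' →* AlgebraicClosure k) y
  have htoUnit : ∀ y : k'ˣ, ((toUnit y : (AlgebraicClosure k)ˣ) : AlgebraicClosure k) = φ y :=
    fun _ => rfl
  let a : invariants (A := (AlgebraicClosure k)ˣ) H := ⟨toUnit x, hinv _ (hmem _)⟩
  have ha : a = 1 := by
    refine hinj a fun n => ?_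
    obtain ⟨y, hy⟩ := hx n n.2
    refine ⟨⟨toUnit y, hinv _ (hmem _)⟩, ?_⟩
    apply Subtype.ext
    change toUnit y ^ (n : ℕ) = toUnit x
    rw [← hy]
    exact (map_pow (Units.map (φ : k' →* AlgebraicClosure k)) y n).symm
  have hval : φ (x : k') = 1 := by
    have := congrArg (fun z : invariants (A := (AlgebraicClosure k)ˣ) H =>
      ((z : (AlgebraicClosure k)ˣ) : AlgebraicClosure k)) ha
    simpa [a, htoUnit] using this
  apply Units.ext
  exact hφinj (by rw [hval, Units.val_one, map_one])

/-- **Def. 1.5, (a) ⇔ (b) for tori** ("either of the following two equivalent conditions", p. 32):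
over a field of characteristic zero, torally Kummer-faithful (condition (a) for `𝔾_m` over every
finite extension) is equivalent to the injectivity of the Kummer maps `((k̄)^×)^H → H¹(H, Λ((k̄)^×))`
for all open `H ≤ G_k`.  PROVED (the Kummer-theoretic half is abc-iut L2's
`kummerMapFixed_injective_iff_absoluteGaloisGroup`). [cite: MochizukiAbsTopIII2015, Def 1.5 p.32] -/
theorem isTorallyKummerFaithful_iff_def_1_5_b_toral :
    IsTorallyKummerFaithful k ↔ Def_1_5_b_toral k :=
  ⟨def_1_5_b_toral_of_isTorallyKummerFaithful, isTorallyKummerFaithful_of_def_1_5_b_toral⟩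

end Galois

end Literature.AnabelianGeometry.AbsoluteAnabelian.AbsTopIII
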